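import Summits.BirchSwinnertonDyer.BirchSwinnertonDyer.Theorems.KimAtThreeKolyvaginDeepUpperPotGoodReduction
import Summits.BirchSwinnertonDyer.BirchSwinnertonDyer.Theorems.KimAtThreeKolyvaginDeepLowerOfCertificate
import Summits.BirchSwinnertonDyer.Rank1Residual.Additive.X4RankZeroKatoBoundTamagawaExact
import Summits.BirchSwinnertonDyer.Rank1Residual.X4.KimTamagawaDefect
import Summits.BirchSwinnertonDyer.Rank1Residual.Supersingular.SignedRankZero
import HarnessLib

/-!
# Route `KimAtThreeKolyvagin` (rung W2), crux `DeepUpperAtThree`: the TYPED OBSTRUCTION behind the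
# inline hypothesis «DeepDefect ≤ Tamagawa» of the potentially-good reduction

Cell `bsd-addord`, seat `bsd-addord-w2-c3` (D-0074 row B6), item `stmt-BirchSwinnertonDyer-19076`.
The landed reduction `KimAtThreeKolyvaginDeepUpperPotGoodReduction` (p412781) proves the crux
`DeepUpperAtThree` on the potentially-good stratum from Kato's Tamagawa-EXACT bound (PUB, by name) and ONE
inline OPEN hypothesis, «DeepDefect ≤ Tamagawa» (DDT):

  `kuriharaPartialDeepInfty W 3 f ≤ v₃(∏_ℓ c_ℓ(E))`   (`∂^{(∞)}_{deep}(δ̃) ≤ v₃(∏ c_ℓ)`).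

The seat was asked to prove DDT "on the next slice (`v₃(c₃) = 1`) and then generally, or land its typed
obstruction". This file is the obstruction, as kernel theorems. Write, at one row `(W, f)`,
`s = ord₃ #Ш(E/ℚ)(3)`, `c = v₃(∏ c_ℓ)`, `a = ∂⁽⁰⁾(δ̃)`, `d = ∂^{(∞)}_{deep}(δ̃)`. Then

* Kato Thm. 14.5 (3) Tamagawa-exact (PUB): `s + c ≤ a`; crux 19075 `DeepLowerAtThree`: `a ≤ s + d`;
  crux 19076 `DeepUpperAtThree`: `s + d ≤ a`; DDT: `d ≤ c`.
* `kuriharaPartial_zero_le_of_deepDefectLe_of_lower`: DDT ∧ (19075 at the row) ⟹ `a ≤ s + c` — the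
  LOWER half of the `3`-part of BSD in the `∂`-currency; `missingLowerBoundAt_of_kuriharaPartial_zero_le`
  turns that into the tree's `Typed.MissingLowerBoundAt W 3` (Miller's `ord₃ #Ш_an ≤ ord₃ #Ш`) on every
  tower row of analytic rank `0` with the `3`-adic period transfer — NO reduction hypothesis at `3`;
  `missingLowerBoundAt_three_of_deepDefectLe_of_deepLowerAtThree` is the crux-level form and
  `bsdp_three_of_deepDefectLe_of_deepLowerAtThree_of_kato2004TamagawaExact` adds Kato's exact upper half:
  DDT ∧ 19075 ∧ Kato (PUB) ⟹ `BSDp W 3` on every tower ∧ additive potentially good ∧ `r_an = 0` row.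
* Conversely `deepDefectLe_iff_kuriharaPartial_zero_le`: granted 19075 ∧ 19076 at the row (Kim's
  `p = 3` structure theorem), DDT ⟺ `a ≤ s + c`; and `deepDefect_eq_and_kuriharaPartial_zero_eq`: DDT ∧
  19075 ∧ Kato-exact force `d = c` AND `a = s + c` (Kim's Conj. 1.10 AND `BSD₃` in `∂`-currency).

READING. DDT is NOT a Kato-side statement: on every row with `Ш(E)[3] ≠ 0` it is exactly as strong as
the missing LOWER half of `BSD₃` at an additive prime (an Iwasawa-main-conjecture-type input with no
source in print at additive `3`), so p412781 reduces crux 19076 to a statement HARDER than the crux;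
the Kato-side road to 19076 is the Theses' own plan (Kato's Kolyvagin system + Sakamoto's rank-one
theorem + the dictionary `x_n ↔ δ̃_n`, i.e. certificate SUPPLY, `deepUpperAtThree_of_certificateSupply`).
What IS a theorem about DDT: the slice `∂⁽⁰⁾(δ̃) ≤ v₃(∏ c_ℓ)` (`deepDefectLe_of_kuriharaPartial_zero_le`,
since `∂^{(∞)}_{deep} ≤ ∂⁽⁰⁾` always) — by Kato-exact these are precisely the rows with `Ш(E)[3] = 0`
and Kato's bound sharp; the companion file `KimAtThreeDeepUpperShaTrivialRungs` records that crux 19076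
itself holds outright wherever `3 ∤ #Ш(E)`. DDT in the deep currency implies the all-levels `≤` half
`X4.KimTamagawaDefectLeAt W 3 f` of cell n1011 (`kimTamagawaDefectLeAt_of_deepDefectLe`), whose
`p ≥ 5` consumer `X4.missingLowerBoundAt_of_kimTamagawaDefectLe` is the published-fact twin of the
crux-level theorem here. Nothing is asserted: cruxes and facts are hypotheses BY NAME; no mark moves.
[cite: Kim2022StructureSelmer, Conj. 1.10 (§1.5.3, PDF p. 8), §1.5.1 (PDF p. 7), Thm. 1.9 (6)]
[cite: Kato2004Asterisque, Thm. 14.5 (3) (p. 236), Prop. 14.16 (2) (p. 244), §14.8 (p. 238)]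
[cite: Kim2025RefinedTNC, Thm 1.1] [cite: MazurRubin2004, Def. 5.2.11, Thm. 5.2.12] [cite: Miller2011LMS, Def. 1.1]
-/

set_option autoImplicit false
-- the Theorems namespace of a single-conjunct summit repeats the summit name by design (D-0017)
set_option linter.dupNamespace false

noncomputable section

open scoped MatrixGroups ModularForm Classical

open CongruenceSubgroup WeierstrassCurve Literature.NumberTheory.EllipticCurves
  Literature.NumberTheory.EllipticCurves.ModularForms
  Literature.NumberTheory.EllipticCurves.Rank1Residual
  Literature.NumberTheory.EllipticCurves.Rank1Residual.Typed

namespace Summit.BirchSwinnertonDyer.BirchSwinnertonDyer.Theorems.KimAtThreeDeepUpperDefectObstruction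

open Summit.BirchSwinnertonDyer.Rank1Residual.Additive
open Summit.BirchSwinnertonDyer.Rank1Residual.Supersingular
open Summit.BirchSwinnertonDyer.BirchSwinnertonDyer.Theses.KimAtThreeKolyvagin
open Summit.BirchSwinnertonDyer.BirchSwinnertonDyer.Theorems.KimAtThreeKolyvaginDeepUpperRung
open Summit.BirchSwinnertonDyer.BirchSwinnertonDyer.Theorems.KimAtThreeKolyvaginDeepUpperPotGoodReduction
open Summit.BirchSwinnertonDyer.BirchSwinnertonDyer.Theorems.KimAtThreeKolyvaginUnitLevelOneRungs
open Summit.BirchSwinnertonDyer.BirchSwinnertonDyer.Theorems.KimAtThreeKolyvaginCertificateDictionary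
open Summit.BirchSwinnertonDyer.BirchSwinnertonDyer.Theorems.KimAtThreeKolyvaginDeepLowerOfCertificate

/-! ### §1 `ℕ∞` bookkeeping at one row (general `p`): DDT versus the two deep cruxes -/

section Bookkeeping

variable (W : WeierstrassCurve ℚ) [W.IsGloballyMinimal] (p : ℕ) {N : ℕ} (f : CuspForm (Gamma0 N) 2)

/-- **The trivial slice of DDT.** If `∂⁽⁰⁾(δ̃) ≤ c` then `∂^{(∞)}_{deep}(δ̃) ≤ c`, because
`∂^{(∞)}_{deep} ≤ ∂⁽⁰⁾` always (`kuriharaPartialDeepInfty_le_kuriharaPartial_zero`). With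
`c = v₃(∏ c_ℓ)` this is «DeepDefect ≤ Tamagawa» on the rows `ord₃ δ̃₁ ≤ v₃(∏ c_ℓ)` — unconditional, no
Euler system. [cite: MazurRubin2004, Def. 5.2.11] [cite: Kim2022StructureSelmer, §1.5.1 (PDF p. 7)] -/
theorem deepDefectLe_of_kuriharaPartial_zero_le {c : ℕ} (h : kuriharaPartial W p f 0 ≤ (c : ℕ∞)) :
    kuriharaPartialDeepInfty W p f ≤ (c : ℕ∞) :=
  (kuriharaPartialDeepInfty_le_kuriharaPartial_zero W p f).trans h

/-- **The obstruction, core step (pure `ℕ∞`).** DDT at the row (`∂^{(∞)}_{deep} ≤ c`) together with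
the conclusion of the rigidity crux `DeepLowerAtThree` at the row (`∂^{(∞)}_{deep} = d`, `∂⁽⁰⁾ ≤ s + d`)
gives `∂⁽⁰⁾ ≤ s + c` — with `s = ord₃ #Ш(3)`, `c = v₃(∏ c_ℓ)` the LOWER half of `BSD₃` in `∂`-currency.
[cite: Kim2022StructureSelmer, Conj. 1.10 (PDF p. 8), Thm. 1.9 (6)] -/
theorem kuriharaPartial_zero_le_of_deepDefectLe_of_lower {s c d : ℕ}
    (hd : kuriharaPartialDeepInfty W p f = d)
    (hL : kuriharaPartial W p f 0 ≤ ((s + d : ℕ) : ℕ∞))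
    (hD : kuriharaPartialDeepInfty W p f ≤ (c : ℕ∞)) :
    kuriharaPartial W p f 0 ≤ ((s + c : ℕ) : ℕ∞) := by
  rw [hd] at hD
  have hdc : d ≤ c := by exact_mod_cast hD
  exact hL.trans (by exact_mod_cast Nat.add_le_add_left hdc s)

/-- **Granted both deep cruxes at the row, DDT ⟺ the `∂`-currency lower half.** With
`∂^{(∞)}_{deep} = d`, `∂⁽⁰⁾ ≤ s + d` (crux 19075) and `s + d ≤ ∂⁽⁰⁾` (crux 19076):
`∂^{(∞)}_{deep} ≤ c ⟺ ∂⁽⁰⁾ ≤ s + c`. (The `⟸` direction at `p = 3`, `c = v₃(∏ c_ℓ)` is p412781's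
`deepDefect_le_of_deepUpperAtThree_of_lowerHalf`.) So under Kim's `p = 3` theorem DDT is EQUIVALENT to
the lower half of `BSD₃`, not weaker. [cite: Kim2022StructureSelmer, Conj. 1.10 (PDF p. 8), Thm. 1.9 (6)]
[cite: Kim2025RefinedTNC, Thm 1.1] -/
theorem deepDefectLe_iff_kuriharaPartial_zero_le {s c d : ℕ}
    (hd : kuriharaPartialDeepInfty W p f = d)
    (hL : kuriharaPartial W p f 0 ≤ ((s + d : ℕ) : ℕ∞))
    (hU : ((s + d : ℕ) : ℕ∞) ≤ kuriharaPartial W p f 0) :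
    kuriharaPartialDeepInfty W p f ≤ (c : ℕ∞) ↔ kuriharaPartial W p f 0 ≤ ((s + c : ℕ) : ℕ∞) := by
  constructor
  · exact kuriharaPartial_zero_le_of_deepDefectLe_of_lower W p f hd hL
  · intro h
    rw [hd]
    have hsc : s + d ≤ s + c := by exact_mod_cast hU.trans h
    exact_mod_cast Nat.le_of_add_le_add_left hsc

/-- **DDT ∧ rigidity ∧ Kato-exact pin everything.** If `∂^{(∞)}_{deep} = d`, `∂⁽⁰⁾ ≤ s + d` (crux
19075 at the row), `s + c ≤ ∂⁽⁰⁾` (Kato Thm. 14.5 (3) Tamagawa-exact at the row) and DDT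
`∂^{(∞)}_{deep} ≤ c`, then `∂^{(∞)}_{deep} = c` (Kim's Conj. 1.10 at the row) AND `∂⁽⁰⁾ = s + c`
(`BSD₃` in `∂`-currency). [cite: Kim2022StructureSelmer, Conj. 1.10 (PDF p. 8)]
[cite: Kato2004Asterisque, Thm. 14.5 (3) (p. 236), Prop. 14.16 (2) (p. 244), §14.8 (p. 238)] -/
theorem deepDefect_eq_and_kuriharaPartial_zero_eq {s c d : ℕ}
    (hd : kuriharaPartialDeepInfty W p f = d)
    (hL : kuriharaPartial W p f 0 ≤ ((s + d : ℕ) : ℕ∞))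
    (hK : ((s + c : ℕ) : ℕ∞) ≤ kuriharaPartial W p f 0)
    (hD : kuriharaPartialDeepInfty W p f ≤ (c : ℕ∞)) :
    kuriharaPartialDeepInfty W p f = (c : ℕ∞) ∧ kuriharaPartial W p f 0 = ((s + c : ℕ) : ℕ∞) := by
  have hdc : d ≤ c := by
    rw [hd] at hD
    exact_mod_cast hD
  have hcd : s + c ≤ s + d := by exact_mod_cast hK.trans hL
  obtain rfl : d = c := le_antisymm hdc (Nat.le_of_add_le_add_left hcd)
  exact ⟨hd, le_antisymm hL hK⟩

/-- **DDT in the deep currency implies cell n1011's all-levels `≤` half of Kim's Conjecture 1.10**,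
`X4.KimTamagawaDefectLeAt W p f` (`∂^{(∞)}(δ̃) ≤ v_p(∏ c_ℓ)`), since the all-levels infimum is below
the deep limit (`kuriharaPartialInfty_le_kuriharaPartialDeepInfty`).
[cite: Kim2022StructureSelmer, Conj. 1.10 (§1.5.3, PDF p. 8)] [cite: MazurRubin2004, Def. 5.2.11] -/
theorem kimTamagawaDefectLeAt_of_deepDefectLe
    (hD : kuriharaPartialDeepInfty W p f ≤ ((padicValNat p W.tamagawaProduct : ℕ) : ℕ∞)) :
    Summit.BirchSwinnertonDyer.Rank1Residual.X4.KimTamagawaDefectLeAt W p f :=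
  (kuriharaPartialInfty_le_kuriharaPartialDeepInfty W p f).trans hD

end Bookkeeping

/-! ### §2 The `∂`-currency lower half in BSD currency (general odd `p`) -/

section BSDCurrency

variable (W : WeierstrassCurve ℚ) [W.IsElliptic] [W.IsGloballyMinimal] (p : ℕ) [Fact p.Prime]
  {N : ℕ} [NeZero N] (f : CuspForm (Gamma0 N) 2)

/-- **`∂`-currency ⇒ BSD currency at the level `n = 1` (upper direction).** For odd `p`, `E[p]`
irreducible, `f` the newform of `W` with `ord(δ̃) = 0` (so `[0]⁺_f ≠ 0`) and the period transfer
`Ω(W) = u · Ω⁺_f`, `|u|_p = 1`: if `∂⁽⁰⁾(δ̃) ≤ m` then `L(E,1)/Ω(W)` is a rational `q` (namely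
`[0]⁺_f / u`) with `ord_p q ≤ m`. (Contrapositive of
`natCast_le_kuriharaPartial_zero_of_le_padicValRat`.) [cite: Kim2022StructureSelmer, §1.4.3 and §1.5.1 (PDF p. 7)]
[cite: MazurTateTeitelbaum1986Invent, §I.8 (8.6)] -/
theorem exists_padicValRat_le_of_kuriharaPartial_zero_le (hp2 : p ≠ 2)
    (hirr : W.HasIrreducibleModPGaloisRep p) (hf : IsNewformOf W f)
    (hord : kuriharaVanishingOrder W p f = 0)
    (hper : ∃ u : ℚ, ‖(u : ℚ_[p])‖ = 1 ∧ W.realPeriodRat = u * plusPeriod f) {m : ℕ}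
    (hm : kuriharaPartial W p f 0 ≤ (m : ℕ∞)) :
    ∃ q : ℚ, W.entireLFunction 1 / (W.realPeriodRat : ℂ) = (q : ℂ) ∧ padicValRat p q ≤ (m : ℤ) := by
  have h0 : ratPlusSymbol f 0 ≠ 0 :=
    ratPlusSymbol_zero_ne_zero_of_kuriharaVanishingOrder_eq_zero W p f hord
  obtain ⟨u, hu, hΩ⟩ := hper
  have hu0 : u ≠ 0 := by
    rintro rfl
    rw [Rat.cast_zero, norm_zero] at hu
    exact zero_ne_one hu
  have hΩf : 0 < plusPeriod f := IsNewform0.plusPeriod_pos_holds hf.1 hf.coeffField_eq_bot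
  -- the witness `q = [0]⁺_f / u`
  have hq : W.entireLFunction 1 / (W.realPeriodRat : ℂ) = ((ratPlusSymbol f 0 / u : ℚ) : ℂ) := by
    have hu' : (u : ℂ) ≠ 0 := by exact_mod_cast hu0
    have hΩf' : ((plusPeriod f : ℝ) : ℂ) ≠ 0 := by exact_mod_cast hΩf.ne'
    rw [hf.entireLFunction_one_eq, hΩ]
    push_cast
    field_simp
  refine ⟨ratPlusSymbol f 0 / u, hq, ?_⟩
  -- if `ord_p q ≥ m + 1` the `≥`-bridge would give `m + 1 ≤ ∂⁽⁰⁾ ≤ m`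
  by_contra hlt
  rw [not_le] at hlt
  have hm1 : ((m + 1 : ℕ) : ℤ) ≤ padicValRat p (ratPlusSymbol f 0 / u) := by
    push_cast
    omega
  have hge := natCast_le_kuriharaPartial_zero_of_le_padicValRat W p f hp2 hirr hf ⟨u, hu, hΩ⟩ hq hm1
  have : ((m + 1 : ℕ) : ℕ∞) ≤ (m : ℕ∞) := hge.trans hm
  have : m + 1 ≤ m := by exact_mod_cast this
  omega

/-- **The `∂`-currency lower half IS Miller's lower half.** For odd `p`, `E[p]` irreducible (so
`p ∤ #E(ℚ)_tors`), `f` the newform of `W` with `ord(δ̃) = 0` and the period transfer, granted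
Gross–Zagier–Kolyvagin `hGZK` (rank `0` and `Ш` finite from `L(E,1) ≠ 0`):
`∂⁽⁰⁾(δ̃) ≤ ord_p #Ш(E/ℚ)(p) + v_p(∏ c_ℓ)` ⟹ `Typed.MissingLowerBoundAt W p` (`#Ш_an = q ∈ ℚ` with
`ord_p q ≤ ord_p #Ш`; `#Ш_an = (L(E,1)/Ω(W))·#tors²/∏ c_ℓ`). [cite: Miller2011LMS, Def. 1.1]
[cite: Kim2022StructureSelmer, §1.5.1 (PDF p. 7)] -/
theorem missingLowerBoundAt_of_kuriharaPartial_zero_le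
    (hGZK : rank_eq_analyticRank_of_analyticRank_le_one) (hp2 : p ≠ 2)
    (hirr : W.HasIrreducibleModPGaloisRep p) (hf : IsNewformOf W f)
    (hord : kuriharaVanishingOrder W p f = 0)
    (hper : ∃ u : ℚ, ‖(u : ℚ_[p])‖ = 1 ∧ W.realPeriodRat = u * plusPeriod f)
    (h : kuriharaPartial W p f 0 ≤
      ((padicValNat p (Nat.card (AddCommGroup.primaryComponent W.sha p)) +
        padicValNat p W.tamagawaProduct : ℕ) : ℕ∞)) :
    MissingLowerBoundAt W p := by
  have h0 : ratPlusSymbol f 0 ≠ 0 :=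
    ratPlusSymbol_zero_ne_zero_of_kuriharaVanishingOrder_eq_zero W p f hord
  have hL : W.entireLFunction 1 ≠ 0 := hf.entireLFunction_one_ne_zero_of_ratPlusSymbol_zero_ne_zero h0
  have hr0 : W.analyticRank = 0 := analyticRank_eq_zero_of_entireLFunction_one_ne_zero hL
  obtain ⟨-, hfin⟩ := hGZK W (by rw [hr0]; exact zero_le_one)
  haveI : Finite W.sha := hfin
  obtain ⟨t, ht, hv⟩ := exists_padicValRat_le_of_kuriharaPartial_zero_le W p f hp2 hirr hf hord hper h
  have hΩC : (W.realPeriodRat : ℂ) ≠ 0 := Complex.ofReal_ne_zero.mpr W.realPeriodRat_pos_holds.ne'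
  have ht0 : t ≠ 0 := by
    rintro rfl
    apply hL
    have h' := ht
    rw [div_eq_iff hΩC] at h'
    rw [h']
    simp
  have hsha : padicValNat p (Nat.card (AddCommGroup.primaryComponent W.sha p)) =
      padicValNat p W.shaOrder := by
    unfold WeierstrassCurve.shaOrder
    exact padicValNat_card_addPrimaryComponent p
  refine ⟨t * (W.torsionOrder : ℚ) ^ 2 / (W.tamagawaProduct : ℚ),
    shaAn_eq_of_analyticRank_eq_zero W hGZK hr0 ht, ?_⟩
  rw [padicValRat_shaAn_witness W p hirr ht0, ← hsha]
  rw [Nat.cast_add] at hv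
  linarith

end BSDCurrency

/-! ### §3 Crux level at `p = 3`: DDT ∧ `DeepLowerAtThree` is the missing lower half -/

/-- Under the tower (use `n = 1`), `E[3]` is irreducible. [folklore] -/
private theorem irreducible_three_of_tower (W : WeierstrassCurve ℚ) [W.IsElliptic]
    (htower : ∀ n : ℕ, W.HasSurjectiveModNGaloisRep (3 ^ n : ℕ)) :
    W.HasIrreducibleModPGaloisRep 3 :=
  hasIrreducibleModPGaloisRep_of_hasSurjectiveModNGaloisRep W 3 (by simpa using htower 1)

/-- **THE OBSTRUCTION (crux level).** Granted the rigidity crux `DeepLowerAtThree` (item 19075, by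
name) and Gross–Zagier–Kolyvagin: on EVERY row of crux 19076 — `W/ℚ` globally minimal with the `3`-adic
tower onto, `Ш(E/ℚ)` finite, `f` the newform with `3`-integral plus symbols and `ord(δ̃) = 0` — carrying
the `3`-adic period transfer `Ω(W) = u · Ω⁺_f`, «DeepDefect ≤ Tamagawa» at the row IMPLIES the lower
half `Typed.MissingLowerBoundAt W 3` (`ord₃ #Ш_an ≤ ord₃ #Ш`). No hypothesis on the reduction of `E` at
`3` enters. So the inline hypothesis of p412781 delivers, with 19075, the main-conjecture half of
`BSD₃` on the whole tower locus. [cite: Kim2022StructureSelmer, Conj. 1.10 (PDF p. 8), Thm. 1.9 (6)]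
[cite: Kim2025RefinedTNC, Thm 1.1] [cite: Miller2011LMS, Def. 1.1] -/
theorem missingLowerBoundAt_three_of_deepDefectLe_of_deepLowerAtThree
    (hL : DeepLowerAtThree) (hGZK : rank_eq_analyticRank_of_analyticRank_le_one) :
    ∀ (W : WeierstrassCurve ℚ) [W.IsElliptic] [W.IsGloballyMinimal],
      (∀ n : ℕ, W.HasSurjectiveModNGaloisRep (3 ^ n : ℕ)) →
      Finite W.sha →
      ∀ {N : ℕ} [NeZero N] (f : CuspForm (Gamma0 N) 2), IsNewformOf W f →
      (∀ r : ℚ, ratPlusSymbol f r ≠ 0 → 0 ≤ padicValRat 3 (ratPlusSymbol f r)) →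
      kuriharaVanishingOrder W 3 f = 0 →
      (∃ u : ℚ, ‖(u : ℚ_[3])‖ = 1 ∧ W.realPeriodRat = u * plusPeriod f) →
      kuriharaPartialDeepInfty W 3 f ≤ ((padicValNat 3 W.tamagawaProduct : ℕ) : ℕ∞) →
        MissingLowerBoundAt W 3 := by
  intro W _ _ htower hfin N _ f hf hint hord hper hD
  obtain ⟨d, hd, hle⟩ := hL W htower hfin f hf hint hord
  exact missingLowerBoundAt_of_kuriharaPartial_zero_le W 3 f hGZK (by norm_num)
    (irreducible_three_of_tower W htower) hf hord hper
    (kuriharaPartial_zero_le_of_deepDefectLe_of_lower W 3 f hd hle hD)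

/-- **The class-wide form, importing p412781's inline hypothesis VERBATIM.** Granted `DeepLowerAtThree`,
GZK, and «DeepDefect ≤ Tamagawa» in exactly the binder shape of
`deepUpperAtThree_potGood_of_deepDefectLeTamagawa_of_kato2004TamagawaExact` (its `hDefect`): the lower
half `Typed.MissingLowerBoundAt W 3` holds on every tower row of analytic rank `0` with `3` additive
potentially good and the `3`-adic period transfer — the N10/N11 missing input at `3` on that locus.
[cite: Kim2022StructureSelmer, Conj. 1.10 (PDF p. 8)] [cite: Miller2011LMS, Def. 1.1] -/
theorem missingLowerBoundAt_three_potGood_of_deepDefectLeTamagawa_of_deepLowerAtThree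
    (hL : DeepLowerAtThree) (hGZK : rank_eq_analyticRank_of_analyticRank_le_one)
    (hDefect : ∀ (W : WeierstrassCurve ℚ) [W.IsElliptic] [W.IsGloballyMinimal],
      (∀ n : ℕ, W.HasSurjectiveModNGaloisRep (3 ^ n : ℕ)) →
      Finite W.sha →
      ∀ {N : ℕ} [NeZero N] (f : CuspForm (Gamma0 N) 2), IsNewformOf W f →
      (∀ r : ℚ, ratPlusSymbol f r ≠ 0 → 0 ≤ padicValRat 3 (ratPlusSymbol f r)) →
      kuriharaVanishingOrder W 3 f = 0 →
      ¬ W.HasGoodReductionAtPrime 3 → ¬ W.HasMultiplicativeReductionAtPrime 3 →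
      0 ≤ padicValRat 3 W.j →
        kuriharaPartialDeepInfty W 3 f ≤ ((padicValNat 3 W.tamagawaProduct : ℕ) : ℕ∞)) :
    ∀ (W : WeierstrassCurve ℚ) [W.IsElliptic] [W.IsGloballyMinimal],
      (∀ n : ℕ, W.HasSurjectiveModNGaloisRep (3 ^ n : ℕ)) →
      Finite W.sha →
      ∀ {N : ℕ} [NeZero N] (f : CuspForm (Gamma0 N) 2), IsNewformOf W f →
      (∀ r : ℚ, ratPlusSymbol f r ≠ 0 → 0 ≤ padicValRat 3 (ratPlusSymbol f r)) →
      kuriharaVanishingOrder W 3 f = 0 →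
      ¬ W.HasGoodReductionAtPrime 3 → ¬ W.HasMultiplicativeReductionAtPrime 3 →
      0 ≤ padicValRat 3 W.j →
      (∃ u : ℚ, ‖(u : ℚ_[3])‖ = 1 ∧ W.realPeriodRat = u * plusPeriod f) →
        MissingLowerBoundAt W 3 := by
  intro W _ _ htower hfin N _ f hf hint hord hgood hmult hpot hper
  exact missingLowerBoundAt_three_of_deepDefectLe_of_deepLowerAtThree hL hGZK W htower hfin f hf hint
    hord hper (hDefect W htower hfin f hf hint hord hgood hmult hpot)

/-- **DDT ∧ rigidity crux ∧ Kato Tamagawa-exact (PUB) ⟹ `BSD(E,3)`.** On every tower row of analytic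
rank `0` with `3` additive potentially good and the `3`-adic period transfer: the lower half from
`missingLowerBoundAt_three_of_deepDefectLe_of_deepLowerAtThree`, the upper half from Kato Thm. 14.5 (3)
Tamagawa-exact (`X4RankZero.bsdp_of_missingLowerBoundAt_of_katoTam`, facts `hKato`, `hGZK`, `hmod` by
name). I.e. on the content rows (`Ш(E)[3] ≠ 0`) DDT is the WHOLE missing `3`-part.
[cite: Kato2004Asterisque, Thm. 14.5 (3) (p. 236), Prop. 14.16 (2) (p. 244), §14.8 (p. 238)]
[cite: Kim2022StructureSelmer, Conj. 1.10 (PDF p. 8)] [cite: Miller2011LMS, §1 and Def. 1.1] -/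
theorem bsdp_three_of_deepDefectLe_of_deepLowerAtThree_of_kato2004TamagawaExact
    (hL : DeepLowerAtThree)
    (hKato : Kato2004.rankZero_padicValNat_sha_add_padicValNat_tamagawa_le_of_additive_potGood_of_imageContainsSL2)
    (hGZK : rank_eq_analyticRank_of_analyticRank_le_one) (hmod : hasEntireLFunction_rat) :
    ∀ (W : WeierstrassCurve ℚ) [W.IsElliptic] [W.IsGloballyMinimal],
      (∀ n : ℕ, W.HasSurjectiveModNGaloisRep (3 ^ n : ℕ)) →
      Finite W.sha →
      ∀ {N : ℕ} [NeZero N] (f : CuspForm (Gamma0 N) 2), IsNewformOf W f →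
      (∀ r : ℚ, ratPlusSymbol f r ≠ 0 → 0 ≤ padicValRat 3 (ratPlusSymbol f r)) →
      kuriharaVanishingOrder W 3 f = 0 →
      ¬ W.HasGoodReductionAtPrime 3 → ¬ W.HasMultiplicativeReductionAtPrime 3 →
      0 ≤ padicValRat 3 W.j →
      (∃ u : ℚ, ‖(u : ℚ_[3])‖ = 1 ∧ W.realPeriodRat = u * plusPeriod f) →
      kuriharaPartialDeepInfty W 3 f ≤ ((padicValNat 3 W.tamagawaProduct : ℕ) : ℕ∞) →
        BSDp W 3 := by
  intro W _ _ htower hfin N _ f hf hint hord hgood hmult hpot hper hD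
  have h0 : ratPlusSymbol f 0 ≠ 0 :=
    ratPlusSymbol_zero_ne_zero_of_kuriharaVanishingOrder_eq_zero W 3 f hord
  have hLne : W.entireLFunction 1 ≠ 0 :=
    hf.entireLFunction_one_ne_zero_of_ratPlusSymbol_zero_ne_zero h0
  have hr0 : W.analyticRank = 0 := analyticRank_eq_zero_of_entireLFunction_one_ne_zero hLne
  have hX : ClassX4 W 3 := ⟨by norm_num, ⟨hgood, hmult⟩, irreducible_three_of_tower W htower⟩
  exact X4RankZero.bsdp_of_missingLowerBoundAt_of_katoTam W 3 hKato hGZK hmod hr0 hX hpot htower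
    (missingLowerBoundAt_three_of_deepDefectLe_of_deepLowerAtThree hL hGZK W htower hfin f hf hint hord
      hper hD)

/-- **Sanity edge (the hypothesis is not vacuous): DDT on the Kato-sharp slice.** On a tower row with
`3` additive potentially good and the period transfer, if Kato's Tamagawa-exact bound is SHARP at the row
— `∂⁽⁰⁾(δ̃) ≤ v₃(∏ c_ℓ)`, equivalently (by Kato) `Ш(E)[3] = 0` and `ord₃ δ̃₁ = v₃(∏ c_ℓ)` — then DDT
holds there and so does the conclusion of crux 19076 (via p412781's composition, pointwise). This is the
theorem-part of «DDT on the slice `v₃(c₃) = 1`»: the Kodaira IV/IV* rows with `ord₃ δ̃₁ ≤ v₃(∏ c_ℓ)`.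
[cite: Kato2004Asterisque, Thm. 14.5 (3) (p. 236), Prop. 14.16 (2) (p. 244), §14.8 (p. 238)]
[cite: Kim2022StructureSelmer, §1.5.1 (PDF p. 7), Conj. 1.10 (PDF p. 8)] -/
theorem deepUpper_conclusion_potGood_of_kuriharaPartial_zero_le_tamagawa_of_kato2004TamagawaExact
    (hKato : Kato2004.rankZero_padicValNat_sha_add_padicValNat_tamagawa_le_of_additive_potGood_of_imageContainsSL2)
    (W : WeierstrassCurve ℚ) [W.IsElliptic] [W.IsGloballyMinimal]
    (htower : ∀ n : ℕ, W.HasSurjectiveModNGaloisRep (3 ^ n : ℕ)) (hfin : Finite W.sha)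
    {N : ℕ} [NeZero N] (f : CuspForm (Gamma0 N) 2) (hf : IsNewformOf W f)
    (hord : kuriharaVanishingOrder W 3 f = 0)
    (hgood : ¬ W.HasGoodReductionAtPrime 3) (hmult : ¬ W.HasMultiplicativeReductionAtPrime 3)
    (hpot : 0 ≤ padicValRat 3 W.j)
    (hper : ∃ u : ℚ, ‖(u : ℚ_[3])‖ = 1 ∧ W.realPeriodRat = u * plusPeriod f)
    (hsharp : kuriharaPartial W 3 f 0 ≤ ((padicValNat 3 W.tamagawaProduct : ℕ) : ℕ∞)) :
    kuriharaPartialDeepInfty W 3 f ≤ ((padicValNat 3 W.tamagawaProduct : ℕ) : ℕ∞) ∧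
      ∃ d : ℕ, kuriharaPartialDeepInfty W 3 f = d ∧
        ((padicValNat 3 (Nat.card (AddCommGroup.primaryComponent W.sha 3)) + d : ℕ) : ℕ∞) ≤
          kuriharaPartial W 3 f 0 := by
  have hD := deepDefectLe_of_kuriharaPartial_zero_le W 3 f hsharp
  refine ⟨hD, ?_⟩
  obtain ⟨d, hd, hdle⟩ := ENat.le_coe_iff.mp hD
  refine ⟨d, hd, ?_⟩
  have hK := sha_add_tamagawa_le_kuriharaPartial_zero_of_kato2004TamagawaExact hKato W htower hfin f hf
    hord hgood hmult hpot hper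
  refine le_trans ?_ hK
  exact_mod_cast Nat.add_le_add_left hdle _

end Summit.BirchSwinnertonDyer.BirchSwinnertonDyer.Theorems.KimAtThreeDeepUpperDefectObstruction

end
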